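import Mathlib.Analysis.Complex.LocallyUniformLimit
import Mathlib.Analysis.Complex.RealDeriv
import Mathlib.Analysis.Calculus.IteratedDeriv.Lemmas
import Summits.CriticalPhenomena.CardyFormulaZ2.Theorems.CardyUSTContinuationTargetStubWindowGlue

/-!
# Crux `Target` (stmt-CriticalPhenomena-6046, route `CardyUSTContinuation`) — rigidity of the
# conjunction at full strength: sets of uniqueness, and convergence of `t`-derivatives

`Target = SmallFugacityLimit ∧ UniformAnalyticExtension` (X_S ∧ X_A).  The landed window glue
(`CardyUSTContinuationTargetStubWindowGlue`) needs X_S only on SOME window `(a, b) ⊆ (0, 1]`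
once X_A holds.  Here Vitali–Porter is run at full strength, with Weierstrass on top:
* `tendsto_iteratedDeriv_thickening_of_frequently_tendsto` — on the convex `ρ`-thickening `S`
  of `[t₁, 1] ⊆ ℂ`, a family `g δ` holomorphic and bounded by one `M` on `S` (small `δ > 0`)
  converging to a holomorphic `G` at real points ACCUMULATING at a real `c`, `↑c ∈ S`
  (`∃ᶠ s in 𝓝[≠] c, g δ s → G s`), converges on `S` with ALL complex derivatives;
* `hasCrossingLimit_of_frequently`, `tendsto_derivWithin_of_frequently` — one conformal
  rectangle: (A) δ-uniform bounded analytic extensions near every `[t₁, 1]`, (C₂) analytic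
  continuation of `U · η` near `[0, 1]`, and crossing limits along fugacities accumulating at ONE
  point of `(0, 1]` give the crossing limit AND the limit of `t`-derivatives at EVERY `t ∈ (0,1]`;
* `cardyUST_target_iff_frequently : Target ↔ UniformAnalyticExtension ∧ AccLimit` (X_S along
  any sequence of fugacities accumulating in `(0, 1]`, e.g. `qₙ ↑ 1`), `cardyUST_target_derivWithin`
  (`Target` pins `∂_t u_R(t, δ) → ∂_t U(t, η)`, at `t = 1` a statement about Bernoulli(1/2)
  bond percolation alone: a Monte-Carlo falsifier of `Target` at `q = 1`), and the registered
  stub G′ `…Cruxes.Target.CardyUSTContinuationBirth.stub_accGlue` of skeleton v5.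
Ingredients: `Literature.Analysis.Complex.exists_tendstoLocallyUniformlyOn_of_frequently_tendsto`,
`TendstoLocallyUniformlyOn.deriv`, `HasDerivAt.real_of_complex`, landed `continuumFamily_proof`.
-/

namespace Summit.CriticalPhenomena.CardyFormulaZ2.Theorems

open Filter Set Metric Topology Complex
open Literature.Probability.RandomPlanarGeometry Literature.Probability.Percolation
open Summit.CriticalPhenomena.CardyFormulaZ2.Theses.CardyUSTContinuation

/-- **Vitali–Porter + Weierstrass on a thickened segment, accumulation form.** If `g δ` is, for
all small `δ > 0`, holomorphic on the `ρ`-neighbourhood `S` of `[t₁, 1] ⊆ ℂ` and bounded there by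
`M`, `G` is holomorphic on `S`, `↑c ∈ S` for a real `c`, and `g δ s → G s` (`δ → 0⁺`) for real
`s ≠ c` arbitrarily close to `c`, then `iteratedDeriv k (g δ) w → iteratedDeriv k G w` for every
`k` and every `w ∈ S` (Montel + identity theorem on the connected open `S`, then Weierstrass). -/
theorem tendsto_iteratedDeriv_thickening_of_frequently_tendsto {t₁ ρ M c : ℝ}
    (g : ℝ → ℂ → ℂ) (G : ℂ → ℂ)
    (hg : ∀ᶠ δ in 𝓝[>] (0:ℝ),
      DifferentiableOn ℂ (g δ) (thickening ρ (((↑) : ℝ → ℂ) '' Icc t₁ 1)) ∧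
        ∀ z ∈ thickening ρ (((↑) : ℝ → ℂ) '' Icc t₁ 1), ‖g δ z‖ ≤ M)
    (hG : DifferentiableOn ℂ G (thickening ρ (((↑) : ℝ → ℂ) '' Icc t₁ 1)))
    (hc : (c : ℂ) ∈ thickening ρ (((↑) : ℝ → ℂ) '' Icc t₁ 1))
    (hconv : ∃ᶠ s : ℝ in 𝓝[≠] c, Tendsto (fun δ => g δ s) (𝓝[>] 0) (𝓝 (G s))) :
    ∀ k : ℕ, ∀ w ∈ thickening ρ (((↑) : ℝ → ℂ) '' Icc t₁ 1),
      Tendsto (fun δ => iteratedDeriv k (g δ) w) (𝓝[>] 0) (𝓝 (iteratedDeriv k G w)) := by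
  intro k w hw
  set K : Set ℂ := ((↑) : ℝ → ℂ) '' Icc t₁ 1 with hK
  set S : Set ℂ := thickening ρ K with hS
  have hSo : IsOpen S := isOpen_thickening
  have hSc : IsPreconnected S := ((convex_ofReal_image_Icc t₁ 1).thickening ρ).isPreconnected
  -- real points near `c` lie in `S`; `ℝ → ℂ` maps `𝓝[≠] c` into `𝓝[≠] ↑c`
  have hnearS : ∀ᶠ s : ℝ in 𝓝[≠] c, (s : ℂ) ∈ S :=
    mem_nhdsWithin_of_mem_nhds (continuous_ofReal.continuousAt.preimage_mem_nhds (hSo.mem_nhds hc))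
  have htend : Tendsto (fun s : ℝ => (s : ℂ)) (𝓝[≠] c) (𝓝[≠] (c : ℂ)) := by
    refine tendsto_nhdsWithin_iff.2
      ⟨continuous_ofReal.continuousAt.tendsto.mono_left nhdsWithin_le_nhds, ?_⟩
    filter_upwards [self_mem_nhdsWithin] with s hs
    simpa using hs
  -- reduce to sequences `δ n → 0⁺`
  rw [tendsto_iff_seq_tendsto]
  intro δ hδ
  classical
  -- the good indices: `g (δ n)` holomorphic on `S` and bounded by `M`
  set P : ℝ → Prop := fun d => DifferentiableOn ℂ (g d) S ∧ ∀ z ∈ S, ‖g d z‖ ≤ M with hP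
  have hPev : ∀ᶠ n in atTop, P (δ n) := hδ.eventually hg
  -- the repaired sequence
  set F : ℕ → ℂ → ℂ := fun n => if P (δ n) then g (δ n) else fun _ => 0 with hF
  have hFeq : ∀ᶠ n in atTop, F n = g (δ n) := by
    filter_upwards [hPev] with n hn
    simp only [hF, if_pos hn]
  have hFd : ∀ n, DifferentiableOn ℂ (F n) S := by
    intro n
    by_cases hn : P (δ n)
    · simp only [hF, if_pos hn]; exact hn.1
    · simp only [hF, if_neg hn]; exact differentiableOn_const 0
  have hFb : ∀ n, ∀ z ∈ S, ‖F n z‖ ≤ max M 0 := by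
    intro n z hz
    by_cases hn : P (δ n)
    · simp only [hF, if_pos hn]; exact (hn.2 z hz).trans (le_max_left _ _)
    · simp only [hF, if_neg hn, norm_zero]; exact le_max_right _ _
  have hbd : ∀ a ∈ S, ∃ M' : ℝ, ∃ r > 0, ∀ n, ∀ z ∈ ball a r ∩ S, ‖F n z‖ ≤ M' :=
    fun a _ => ⟨max M 0, 1, one_pos, fun n z hz => hFb n z hz.2⟩
  -- pointwise convergence of the repaired sequence at the good real points
  have hpt : ∀ s : ℝ, Tendsto (fun d => g d s) (𝓝[>] 0) (𝓝 (G s)) →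
      Tendsto (fun n => F n s) atTop (𝓝 (G s)) := by
    intro s hs
    refine (hs.comp hδ).congr' ?_
    filter_upwards [hFeq] with n hn
    simp [hn]
  have hfreq : ∃ᶠ z in 𝓝[≠] (c : ℂ), ∃ e : ℂ, Tendsto (fun n => F n z) atTop (𝓝 e) :=
    htend.frequently (hconv.mono fun s hs => ⟨G s, hpt s hs⟩)
  -- Vitali's convergence theorem
  obtain ⟨f, hf, hlim⟩ :=
    Literature.Analysis.Complex.exists_tendstoLocallyUniformlyOn_of_frequently_tendsto hSo hSc
      hFd hbd hc hfreq
  -- the limit is `G` (identity theorem)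
  have hfG : EqOn f G S := by
    have hfr : ∃ᶠ z in 𝓝[≠] (c : ℂ), f z = G z := by
      refine htend.frequently ((hconv.and_eventually hnearS).mono ?_)
      rintro s ⟨hs, hsS⟩
      exact tendsto_nhds_unique (hlim.tendsto_at hsS) (hpt s hs)
    exact (hf.analyticOnNhd hSo).eqOn_of_preconnected_of_frequently_eq (hG.analyticOnNhd hSo) hSc
      hc hfr
  -- Weierstrass: all derivatives converge locally uniformly
  have hder : ∀ k : ℕ, (∀ n, DifferentiableOn ℂ (iteratedDeriv k (F n)) S) ∧
      TendstoLocallyUniformlyOn (fun n => iteratedDeriv k (F n)) (iteratedDeriv k f) atTop S := by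
    intro k
    induction k with
    | zero => simpa only [iteratedDeriv_zero] using ⟨hFd, hlim⟩
    | succ k ih =>
      obtain ⟨hdk, hlk⟩ := ih
      refine ⟨fun n => ?_, ?_⟩
      · rw [iteratedDeriv_succ]
        exact ((hdk n).analyticOnNhd hSo).deriv.differentiableOn
      · have h := hlk.deriv (Eventually.of_forall hdk) hSo
        simpa only [iteratedDeriv_succ, Function.comp_def] using h
  -- conclude at `w ∈ S`
  have h1 : Tendsto (fun n => iteratedDeriv k (F n) w) atTop (𝓝 (iteratedDeriv k f w)) :=
    (hder k).2.tendsto_at hw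
  have h2 : iteratedDeriv k f w = iteratedDeriv k G w :=
    Filter.EventuallyEq.iteratedDeriv_eq k (hfG.eventuallyEq_of_mem (hSo.mem_nhds hw))
  rw [← h2]
  refine h1.congr' ?_
  filter_upwards [hFeq] with n hn
  simp [hn]


/-- **Core, one conformal rectangle and one fugacity.** Under (A) δ-uniform bounded analytic
extensions of `t ↦ u t δ` near every `[t₁, 1]`, (C₂) analytic continuation of each `U · η` near
`[0, 1]`, and (W′) crossing limits `u s · → U s` for fugacities `s ∈ (0, 1]` accumulating at some
`c ∈ (0, 1]`: for `t ∈ (0, 1]` and a uniformizing datum `(φ, x)` there are `0 < t₁ < t`, `ρ > 0`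
and extensions `g δ` of `u · δ` (eventually in `δ`) and `Uc` of `U · (crossRatio x)` near
`[t₁, 1]`, ALL of whose complex derivatives at `t` converge, `g δ ⇝ Uc`, as `δ → 0⁺`. -/
theorem exists_extensions_tendsto_iteratedDeriv_of_frequently (U : ℝ → ℝ → ℝ) (u : ℝ → ℝ → ℝ)
    (R : ConformalRectangle)
    (hA : ∀ t₁ ∈ Set.Ioo (0:ℝ) 1, ∃ ρ > (0:ℝ), ∃ M : ℝ,
      ∀ᶠ δ in 𝓝[>] (0:ℝ), ∃ g : ℂ → ℂ,
        DifferentiableOn ℂ g (Metric.thickening ρ (((↑) : ℝ → ℂ) '' Set.Icc t₁ 1)) ∧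
        (∀ z ∈ Metric.thickening ρ (((↑) : ℝ → ℂ) '' Set.Icc t₁ 1), ‖g z‖ ≤ M) ∧
        ∀ t ∈ Set.Icc t₁ 1, g t = u t δ)
    (hC₂ : ∀ η ∈ Set.Ioo (0:ℝ) 1, ∃ ρ > (0:ℝ), ∃ Uc : ℂ → ℂ,
      DifferentiableOn ℂ Uc (Metric.thickening ρ (((↑) : ℝ → ℂ) '' Set.Icc (0:ℝ) 1)) ∧
        ∀ t ∈ Set.Icc (0:ℝ) 1, Uc t = U t η)
    (hW : ∃ c ∈ Set.Ioc (0:ℝ) 1, ∃ᶠ s in 𝓝[≠] c,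
      s ∈ Set.Ioc (0:ℝ) 1 ∧ R.HasCrossingLimit (fun δ => u s δ) (U s))
    {t : ℝ} (ht : t ∈ Set.Ioc (0:ℝ) 1) {φ : ConformalEquiv UpperHalfPlane.upperHalfPlaneSet R.carrier}
    {x : Fin 4 → ℝ} (hφx : R.IsUniformizing φ x) :
    ∃ t₁ ρ : ℝ, 0 < t₁ ∧ t₁ < t ∧ 0 < ρ ∧ ∃ (g : ℝ → ℂ → ℂ) (Uc : ℂ → ℂ),
      (∀ᶠ δ in 𝓝[>] (0:ℝ),
        DifferentiableOn ℂ (g δ) (Metric.thickening ρ (((↑) : ℝ → ℂ) '' Set.Icc t₁ 1)) ∧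
          ∀ s ∈ Set.Icc t₁ 1, g δ s = u s δ) ∧
      DifferentiableOn ℂ Uc (Metric.thickening ρ (((↑) : ℝ → ℂ) '' Set.Icc t₁ 1)) ∧
      (∀ s ∈ Set.Icc (0:ℝ) 1, Uc s = U s (crossRatio x)) ∧
      ∀ k : ℕ, Tendsto (fun δ => iteratedDeriv k (g δ) t) (𝓝[>] 0)
        (𝓝 (iteratedDeriv k Uc t)) := by
  have hη01 : crossRatio x ∈ Set.Ioo (0:ℝ) 1 :=
    ConformalRectangle.crossRatio_mem_Ioo_of_isUniformizing hφx
  obtain ⟨c, hc, hfr⟩ := hW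
  -- the segment `[t₁, 1]`, `t₁ := min c t / 2`, containing `t` and a neighbourhood of `c`
  set t₁ : ℝ := min c t / 2 with ht₁def
  have hmin : 0 < min c t := lt_min hc.1 ht.1
  have ht₁0 : 0 < t₁ := by rw [ht₁def]; positivity
  have ht₁t : t₁ < t := by
    rw [ht₁def]; linarith [min_le_right c t, ht.1]
  have ht₁c : t₁ < c := by
    rw [ht₁def]; linarith [min_le_left c t, hc.1]
  have ht₁1 : t₁ < 1 := ht₁t.trans_le ht.2
  obtain ⟨ρ, hρ, M, hAev⟩ := hA t₁ ⟨ht₁0, ht₁1⟩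
  obtain ⟨ρ', hρ', Uc, hUc, hUcU⟩ := hC₂ _ hη01
  -- the two complex neighbourhoods and their common shrinking
  set K : Set ℂ := ((↑) : ℝ → ℂ) '' Set.Icc t₁ 1 with hK
  set ρ₀ : ℝ := min ρ ρ' with hρ₀
  have hρ₀0 : 0 < ρ₀ := lt_min hρ hρ'
  have hsub₁ : Metric.thickening ρ₀ K ⊆ Metric.thickening ρ K :=
    Metric.thickening_mono (min_le_left _ _) _
  have hsub₂ : Metric.thickening ρ₀ K ⊆
      Metric.thickening ρ' (((↑) : ℝ → ℂ) '' Set.Icc (0:ℝ) 1) :=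
    (Metric.thickening_mono (min_le_right _ _) _).trans
      (Metric.thickening_subset_of_subset _ (Set.image_mono (Set.Icc_subset_Icc_left ht₁0.le)))
  -- choose the analytic extensions `g δ` (arbitrary where none exists)
  obtain ⟨g, hgP⟩ : ∃ g : ℝ → ℂ → ℂ, ∀ᶠ δ in 𝓝[>] (0:ℝ),
      DifferentiableOn ℂ (g δ) (Metric.thickening ρ K) ∧
      (∀ z ∈ Metric.thickening ρ K, ‖g δ z‖ ≤ M) ∧
      ∀ s ∈ Set.Icc t₁ 1, g δ s = u s δ :=
    ⟨fun δ => Classical.epsilon (fun g : ℂ → ℂ =>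
        DifferentiableOn ℂ g (Metric.thickening ρ K) ∧
        (∀ z ∈ Metric.thickening ρ K, ‖g z‖ ≤ M) ∧
        ∀ s ∈ Set.Icc t₁ 1, g s = u s δ),
      hAev.mono fun δ hδ => Classical.epsilon_spec hδ⟩
  -- the points `t` and `c` lie in the (shrunk) neighbourhood
  have htK : (t : ℂ) ∈ Metric.thickening ρ₀ K :=
    Metric.self_subset_thickening hρ₀0 K ⟨t, ⟨ht₁t.le, ht.2⟩, rfl⟩
  have hcK : (c : ℂ) ∈ Metric.thickening ρ₀ K :=
    Metric.self_subset_thickening hρ₀0 K ⟨c, ⟨ht₁c.le, hc.2⟩, rfl⟩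
  -- convergence at the good fugacities near `c`
  have hconv : ∃ᶠ s : ℝ in 𝓝[≠] c, Tendsto (fun δ => g δ s) (𝓝[>] 0) (𝓝 (Uc s)) := by
    have hnear : ∀ᶠ s : ℝ in 𝓝[≠] c, t₁ < s := mem_nhdsWithin_of_mem_nhds (Ioi_mem_nhds ht₁c)
    refine (hfr.and_eventually hnear).mono ?_
    rintro s ⟨⟨hs01, hHs⟩, hs⟩
    have hsIcc : s ∈ Set.Icc t₁ 1 := ⟨hs.le, hs01.2⟩
    have hlimC : Tendsto (fun δ => ((u s δ : ℝ) : ℂ)) (𝓝[>] 0)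
        (𝓝 ((U s (crossRatio x) : ℝ) : ℂ)) :=
      (Complex.continuous_ofReal.tendsto _).comp (hHs φ x hφx)
    rw [hUcU s ⟨hs01.1.le, hs01.2⟩]
    refine hlimC.congr' ?_
    filter_upwards [hgP] with δ hδ
    exact (hδ.2.2 s hsIcc).symm
  -- Vitali–Porter + Weierstrass on the shrunk neighbourhood
  have hV := tendsto_iteratedDeriv_thickening_of_frequently_tendsto (M := M) g Uc
    (hgP.mono fun δ hδ => ⟨hδ.1.mono hsub₁, fun z hz => hδ.2.1 z (hsub₁ hz)⟩)
    (hUc.mono hsub₂) hcK hconv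
  exact ⟨t₁, ρ₀, ht₁0, ht₁t, hρ₀0, g, Uc,
    hgP.mono fun δ hδ => ⟨hδ.1.mono hsub₁, hδ.2.2⟩, hUc.mono hsub₂, hUcU,
    fun k => hV k _ htK⟩

/-- **Accumulation rigidity, one conformal rectangle (values).** Under (A) and (C₂), crossing
limits `u s · → U s` along fugacities `s ∈ (0, 1]` accumulating at ONE point `c ∈ (0, 1]` (any
sequence `sₙ → c`, `sₙ ≠ c`) give the crossing limit `u t · → U t` for EVERY `t ∈ (0, 1]`. -/
theorem hasCrossingLimit_of_frequently (U : ℝ → ℝ → ℝ) (u : ℝ → ℝ → ℝ) (R : ConformalRectangle)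
    (hA : ∀ t₁ ∈ Set.Ioo (0:ℝ) 1, ∃ ρ > (0:ℝ), ∃ M : ℝ,
      ∀ᶠ δ in 𝓝[>] (0:ℝ), ∃ g : ℂ → ℂ,
        DifferentiableOn ℂ g (Metric.thickening ρ (((↑) : ℝ → ℂ) '' Set.Icc t₁ 1)) ∧
        (∀ z ∈ Metric.thickening ρ (((↑) : ℝ → ℂ) '' Set.Icc t₁ 1), ‖g z‖ ≤ M) ∧
        ∀ t ∈ Set.Icc t₁ 1, g t = u t δ)
    (hC₂ : ∀ η ∈ Set.Ioo (0:ℝ) 1, ∃ ρ > (0:ℝ), ∃ Uc : ℂ → ℂ,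
      DifferentiableOn ℂ Uc (Metric.thickening ρ (((↑) : ℝ → ℂ) '' Set.Icc (0:ℝ) 1)) ∧
        ∀ t ∈ Set.Icc (0:ℝ) 1, Uc t = U t η)
    (hW : ∃ c ∈ Set.Ioc (0:ℝ) 1, ∃ᶠ s in 𝓝[≠] c,
      s ∈ Set.Ioc (0:ℝ) 1 ∧ R.HasCrossingLimit (fun δ => u s δ) (U s)) :
    ∀ t ∈ Set.Ioc (0:ℝ) 1, R.HasCrossingLimit (fun δ => u t δ) (U t) := by
  intro t ht φ x hφx
  obtain ⟨t₁, ρ, _, ht₁t, _, g, Uc, hgP, -, hUcU, hV⟩ :=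
    exists_extensions_tendsto_iteratedDeriv_of_frequently U u R hA hC₂ hW ht hφx
  have h0 := hV 0
  simp only [iteratedDeriv_zero] at h0
  have htC : Uc t = ((U t (crossRatio x) : ℝ) : ℂ) := hUcU t ⟨ht.1.le, ht.2⟩
  have hgt : (fun δ => g δ t) =ᶠ[𝓝[>] (0:ℝ)] fun δ => ((u t δ : ℝ) : ℂ) := by
    filter_upwards [hgP] with δ hδ
    exact hδ.2 t ⟨ht₁t.le, ht.2⟩
  have hC : Tendsto (fun δ => ((u t δ : ℝ) : ℂ)) (𝓝[>] 0)
      (𝓝 ((U t (crossRatio x) : ℝ) : ℂ)) := by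
    rw [← htC]
    exact h0.congr' hgt
  have hR := (Complex.continuous_re.tendsto _).comp hC
  simp only [Function.comp_def, Complex.ofReal_re] at hR
  exact hR

/-- The real part of a function holomorphic near the real point `t`, restricted to the reals,
has (one-sided, within `(-∞, 1]`) derivative the real part of the complex derivative at `t`;
if a real function `v` agrees with it on `[t₁, 1] ∋ t`, `t₁ < t`, so does `v`. -/
theorem hasDerivWithinAt_Iic_of_eqOn_re {h : ℂ → ℂ} {v : ℝ → ℝ} {t₁ t : ℝ} (ht₁t : t₁ < t)
    (ht1 : t ≤ 1) (hd : DifferentiableAt ℂ h t) (hv : ∀ s ∈ Set.Icc t₁ 1, h s = v s) :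
    HasDerivWithinAt v (deriv h t).re (Set.Iic 1) t := by
  have h1 : HasDerivAt (fun s : ℝ => (h s).re) (deriv h t).re t := hd.hasDerivAt.real_of_complex
  refine h1.hasDerivWithinAt.congr_of_eventuallyEq ?_ ?_
  · have hIoi : ∀ᶠ s in 𝓝[Set.Iic 1] t, s ∈ Set.Ioi t₁ :=
      mem_nhdsWithin_of_mem_nhds (Ioi_mem_nhds ht₁t)
    have hnear : ∀ᶠ s in 𝓝[Set.Iic 1] t, s ∈ Set.Ioi t₁ ∧ s ∈ Set.Iic (1:ℝ) :=
      hIoi.and self_mem_nhdsWithin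
    filter_upwards [hnear] with s hs
    simpa using (congrArg Complex.re (hv s ⟨le_of_lt hs.1, hs.2⟩)).symm
  · simpa using (congrArg Complex.re (hv t ⟨ht₁t.le, ht1⟩)).symm

/-- **Accumulation rigidity, one conformal rectangle (derivatives).** Under (A), (C₂), (W′) as
in `hasCrossingLimit_of_frequently`, for every `t ∈ (0, 1]` and uniformizing datum `(φ, x)`:
`∂_t u(t, δ) → ∂_t U(t, crossRatio x)` as `δ → 0⁺` — derivatives within `(-∞, 1]`, so that the
endpoint `t = 1` is covered (ordinary derivatives for `t < 1`, `derivWithin_of_mem_nhds`). -/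
theorem tendsto_derivWithin_of_frequently (U : ℝ → ℝ → ℝ) (u : ℝ → ℝ → ℝ) (R : ConformalRectangle)
    (hA : ∀ t₁ ∈ Set.Ioo (0:ℝ) 1, ∃ ρ > (0:ℝ), ∃ M : ℝ,
      ∀ᶠ δ in 𝓝[>] (0:ℝ), ∃ g : ℂ → ℂ,
        DifferentiableOn ℂ g (Metric.thickening ρ (((↑) : ℝ → ℂ) '' Set.Icc t₁ 1)) ∧
        (∀ z ∈ Metric.thickening ρ (((↑) : ℝ → ℂ) '' Set.Icc t₁ 1), ‖g z‖ ≤ M) ∧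
        ∀ t ∈ Set.Icc t₁ 1, g t = u t δ)
    (hC₂ : ∀ η ∈ Set.Ioo (0:ℝ) 1, ∃ ρ > (0:ℝ), ∃ Uc : ℂ → ℂ,
      DifferentiableOn ℂ Uc (Metric.thickening ρ (((↑) : ℝ → ℂ) '' Set.Icc (0:ℝ) 1)) ∧
        ∀ t ∈ Set.Icc (0:ℝ) 1, Uc t = U t η)
    (hW : ∃ c ∈ Set.Ioc (0:ℝ) 1, ∃ᶠ s in 𝓝[≠] c,
      s ∈ Set.Ioc (0:ℝ) 1 ∧ R.HasCrossingLimit (fun δ => u s δ) (U s))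
    {t : ℝ} (ht : t ∈ Set.Ioc (0:ℝ) 1) {φ : ConformalEquiv UpperHalfPlane.upperHalfPlaneSet R.carrier}
    {x : Fin 4 → ℝ} (hφx : R.IsUniformizing φ x) :
    Tendsto (fun δ => derivWithin (fun s => u s δ) (Set.Iic 1) t) (𝓝[>] 0)
      (𝓝 (derivWithin (fun s => U s (crossRatio x)) (Set.Iic 1) t)) := by
  obtain ⟨t₁, ρ, ht₁0, ht₁t, hρ, g, Uc, hgP, hUc, hUcU, hV⟩ :=
    exists_extensions_tendsto_iteratedDeriv_of_frequently U u R hA hC₂ hW ht hφx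
  have h1 := hV 1
  simp only [iteratedDeriv_one] at h1
  set K : Set ℂ := ((↑) : ℝ → ℂ) '' Set.Icc t₁ 1 with hK
  have htK : (t : ℂ) ∈ Metric.thickening ρ K :=
    Metric.self_subset_thickening hρ K ⟨t, ⟨ht₁t.le, ht.2⟩, rfl⟩
  have hnhds : Metric.thickening ρ K ∈ 𝓝 (t : ℂ) := Metric.isOpen_thickening.mem_nhds htK
  have hut : UniqueDiffWithinAt ℝ (Set.Iic (1:ℝ)) t := uniqueDiffOn_Iic 1 t ht.2
  -- the continuum side
  have hU' : derivWithin (fun s => U s (crossRatio x)) (Set.Iic 1) t = (deriv Uc t).re :=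
    (hasDerivWithinAt_Iic_of_eqOn_re ht₁t ht.2 (hUc.differentiableAt hnhds)
      (fun s hs => hUcU s ⟨ht₁0.le.trans hs.1, hs.2⟩)).derivWithin hut
  -- the lattice side, eventually in `δ`
  have hu' : ∀ᶠ δ in 𝓝[>] (0:ℝ),
      derivWithin (fun s => u s δ) (Set.Iic 1) t = (deriv (g δ) t).re := by
    filter_upwards [hgP] with δ hδ
    exact (hasDerivWithinAt_Iic_of_eqOn_re ht₁t ht.2 (hδ.1.differentiableAt hnhds) hδ.2).derivWithin
      hut
  rw [hU']
  have hR := (Complex.continuous_re.tendsto _).comp h1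
  refine hR.congr' ?_
  filter_upwards [hu'] with δ hδ
  simp [hδ]


/-! ### The route statements: `Target ↔ UniformAnalyticExtension ∧ AccLimit`, derivatives -/

/-- The window form (hence `SmallFugacityLimit`, by `cardyUST_window_of_smallFugacityLimit`)
gives the accumulation form: the good fugacities accumulate at the midpoint of the window. -/
theorem cardyUST_frequently_of_window
    (hW : let Z : ℝ → ℝ → ℝ := fun u x => x ^ (u / 2) * (1 - x) ^ (1 - 3 * u / 2) * ₂F₁ u (1 - u) (2 * u) x; let U : ℝ → ℝ → ℝ := fun t η => t * Z (Real.arccos (-(t / 2)) / Real.pi) η / (Z (Real.arccos (-(t / 2)) / Real.pi) (1 - η) + t * Z (Real.arccos (-(t / 2)) / Real.pi) η); let uJ : Literature.Probability.RandomPlanarGeometry.ConformalRectangle → ℝ → ℝ → ℝ := fun R t δ => if h : 0 < δ then (@Literature.Probability.LatticeModels.fkDomainMeasure R.carrier δ (t / (1 + t)) (t ^ 2) (R.arc 0 ∪ R.arc 2) (Literature.Probability.LatticeModels.meshDomain_finite R.isBounded h).fintype).real (Literature.Probability.Percolation.discreteCrossing R.carrier δ (R.arc 0) (R.arc 2)) else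 0; ∀ R : Literature.Probability.RandomPlanarGeometry.ConformalRectangle, ∃ a b : ℝ, 0 < a ∧ a < b ∧ b ≤ 1 ∧ ∀ t ∈ Set.Ioo a b, R.HasCrossingLimit (fun δ => uJ R t δ) (U t)) :
    let Z : ℝ → ℝ → ℝ := fun u x => x ^ (u / 2) * (1 - x) ^ (1 - 3 * u / 2) * ₂F₁ u (1 - u) (2 * u) x; let U : ℝ → ℝ → ℝ := fun t η => t * Z (Real.arccos (-(t / 2)) / Real.pi) η / (Z (Real.arccos (-(t / 2)) / Real.pi) (1 - η) + t * Z (Real.arccos (-(t / 2)) / Real.pi) η); let uJ : Literature.Probability.RandomPlanarGeometry.ConformalRectangle → ℝ → ℝ → ℝ := fun R t δ => if h : 0 < δ then (@Literature.Probability.LatticeModels.fkDomainMeasure R.carrier δ (t / (1 + t)) (t ^ 2) (R.arc 0 ∪ R.arc 2) (Literature.Probability.LatticeModels.meshDomain_finite R.isBounded h).fintype).real (Literature.Probability.Percolation.discreteCrossing R.carrier δ (R.arc 0) (R.arc 2)) else 0; ∀ R : Literature.Probability.RandomPlanarGeometry.ConformalRectangle, ∃ c ∈ Set.Ioc (0:ℝ)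 1, ∃ᶠ t in 𝓝[≠] c, t ∈ Set.Ioc (0:ℝ) 1 ∧ R.HasCrossingLimit (fun δ => uJ R t δ) (U t) := by
  intro Z U uJ R
  obtain ⟨a, b, ha, hab, hb, hWR⟩ := hW R
  refine ⟨(a + b) / 2, ⟨by linarith, by linarith⟩, ?_⟩
  have hnear : ∀ᶠ t in 𝓝[≠] ((a + b) / 2), t ∈ Set.Ioo a b :=
    mem_nhdsWithin_of_mem_nhds (isOpen_Ioo.mem_nhds ⟨by linarith, by linarith⟩)
  exact (hnear.mono fun t ht => ⟨⟨ha.trans ht.1, ht.2.le.trans hb⟩, hWR t ht⟩).frequently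

/-- **Normal form of the crux at full strength.** `Target ↔ UniformAnalyticExtension ∧ AccLimit`:
given the Lee–Yang crux, the small-fugacity crux is needed, per conformal rectangle, only along
a set of fugacities `q = t²` accumulating at ONE point of `(0, 1]` — any sequence `tₙ → c ∈ (0,1]`,
`tₙ ≠ c` (e.g. `qₙ ↑ 1` at the percolation point), not a window and not small `t`. -/
theorem cardyUST_target_iff_frequently :
    Target ↔ (UniformAnalyticExtension ∧ (let Z : ℝ → ℝ → ℝ := fun u x => x ^ (u / 2) * (1 - x) ^ (1 - 3 * u / 2) * ₂F₁ u (1 - u) (2 * u) x; let U : ℝ → ℝ → ℝ := fun t η => t * Z (Real.arccos (-(t / 2)) / Real.pi) η / (Z (Real.arccos (-(t / 2)) / Real.pi) (1 - η) + t * Z (Real.arccos (-(t / 2)) / Real.pi) η); let uJ : Literature.Probability.RandomPlanarGeometry.ConformalRectangle → ℝ → ℝ → ℝ := fun R t δ => if h : 0 < δ then (@Literature.Probability.LatticeModels.fkDomainMeasure R.carrier δ (t / (1 + t)) (t ^ 2) (R.arc 0 ∪ R.arc 2) (Literature.Probability.LatticeModels.meshDomain_finite R.isBounded h).fintype).real (Literature.Probability.Percolation.discreteCrossing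 R.carrier δ (R.arc 0) (R.arc 2)) else 0; ∀ R : Literature.Probability.RandomPlanarGeometry.ConformalRectangle, ∃ c ∈ Set.Ioc (0:ℝ) 1, ∃ᶠ t in 𝓝[≠] c, t ∈ Set.Ioc (0:ℝ) 1 ∧ R.HasCrossingLimit (fun δ => uJ R t δ) (U t))) := by
  constructor
  · intro hT
    have hS : SmallFugacityLimit := hT.1
    exact ⟨hT.2, cardyUST_frequently_of_window (cardyUST_window_of_smallFugacityLimit hS)⟩
  · rintro ⟨hA, hW⟩
    have hS : SmallFugacityLimit := by
      have hC := continuumFamily_proof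
      unfold ContinuumFamily at hC
      unfold UniformAnalyticExtension at hA
      unfold SmallFugacityLimit
      intro Z U uJ R
      refine ⟨1, one_pos, fun t ht => ?_⟩
      exact hasCrossingLimit_of_frequently _ _ R (hA R) hC.2 (hW R) t ⟨ht.1, ht.2.le⟩
    unfold SmallFugacityLimit at hS
    unfold UniformAnalyticExtension at hA
    exact ⟨hS, hA⟩

/-- **`Target` pins the `t`-derivative of the FK crossing probability for every `t ∈ (0, 1]`.**
Under the crux, for every conformal rectangle `R`, every uniformizing datum `(φ, x)` and every
`t ∈ (0, 1]`, `∂_t u_R(t, δ) → ∂_t U(t, crossRatio x)` as `δ → 0⁺` (derivatives within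
`(-∞, 1]`; ordinary ones for `t < 1`).  At `t = 1` the left side is a covariance under
Bernoulli(1/2) bond percolation of `Ω_δ` (of the crossing indicator with `|ω| + 2 k^joint(ω)`),
so this is a test of `Target` at the percolation point itself (CHEAPEST FALSIFIER by Monte
Carlo, no transfer matrix needed). -/
theorem cardyUST_target_derivWithin (hT : Target) :
    let Z : ℝ → ℝ → ℝ := fun u x => x ^ (u / 2) * (1 - x) ^ (1 - 3 * u / 2) * ₂F₁ u (1 - u) (2 * u) x; let U : ℝ → ℝ → ℝ := fun t η => t * Z (Real.arccos (-(t / 2)) / Real.pi) η / (Z (Real.arccos (-(t / 2)) / Real.pi) (1 - η) + t * Z (Real.arccos (-(t / 2)) / Real.pi) η); let uJ : Literature.Probability.RandomPlanarGeometry.ConformalRectangle → ℝ → ℝ → ℝ := fun R t δ => if h : 0 < δ then (@Literature.Probability.LatticeModels.fkDomainMeasure R.carrier δ (t / (1 + t)) (t ^ 2) (R.arc 0 ∪ R.arc 2) (Literature.Probability.LatticeModels.meshDomain_finite R.isBounded h).fintype).real (Literature.Probability.Percolation.discreteCrossing R.carrier δ (R.arc 0) (R.arc 2)) else 0; ∀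 R : Literature.Probability.RandomPlanarGeometry.ConformalRectangle, ∀ (φ : ConformalEquiv UpperHalfPlane.upperHalfPlaneSet R.carrier) (x : Fin 4 → ℝ), R.IsUniformizing φ x → ∀ t ∈ Set.Ioc (0:ℝ) 1, Tendsto (fun δ => derivWithin (fun s => uJ R s δ) (Set.Iic 1) t) (𝓝[>] 0) (𝓝 (derivWithin (fun s => U s (crossRatio x)) (Set.Iic 1) t)) := by
  have hC := continuumFamily_proof
  unfold ContinuumFamily at hC
  have hS : SmallFugacityLimit := hT.1
  have hA : UniformAnalyticExtension := hT.2
  have hW := cardyUST_frequently_of_window (cardyUST_window_of_smallFugacityLimit hS)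
  unfold UniformAnalyticExtension at hA
  intro Z U uJ R φ x hφx t ht
  exact tendsto_derivWithin_of_frequently _ _ R (hA R) hC.2 (hW R) ht hφx

end Summit.CriticalPhenomena.CardyFormulaZ2.Theorems

/-! ### The registered stub G′ of skeleton v5 (crux `Target`, stmt-CriticalPhenomena-6046) -/

namespace Summit.CriticalPhenomena.CardyFormulaZ2.Cruxes.Target.CardyUSTContinuationBirth

open scoped Topology
open Summit.CriticalPhenomena.CardyFormulaZ2.Theorems
open Summit.CriticalPhenomena.CardyFormulaZ2.Theses.CardyUSTContinuation

/-- **stub_accGlue** (registered stub G′ of skeleton v5 for the crux `Target`): the Lee–Yang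
crux `UniformAnalyticExtension` and the ACCUMULATION form of the small-fugacity crux (for every
conformal rectangle, convergence of the jointly-wired self-dual FK crossing probabilities to the
Miller–Werner law along a set of fugacities accumulating at one point of `(0, 1]`; the route's
`let`s `Z, U, uJ` are characterised by equations rather than bound) give `SmallFugacityLimit`. -/
theorem stub_accGlue :
    Summit.CriticalPhenomena.CardyFormulaZ2.Theses.CardyUSTContinuation.UniformAnalyticExtension → (∀ (Z U : ℝ → ℝ → ℝ) (uJ : Literature.Probability.RandomPlanarGeometry.ConformalRectangle → ℝ → ℝ → ℝ), (∀ u x, Z u x = x ^ (u / 2) * (1 - x) ^ (1 - 3 * u / 2) * ₂F₁ u (1 - u) (2 * u) x) → (∀ t η, U t η = t * Z (Real.arccos (-(t / 2)) / Real.pi) η / (Z (Real.arccos (-(t / 2)) / Real.pi) (1 - η) + t * Z (Real.arccos (-(t / 2)) / Real.pi) η)) → (∀ (R : Literature.Probability.RandomPlanarGeometry.ConformalRectangle) (t δ : ℝ), uJ R t δ = if h : 0 < δ then (@Literature.Probability.LatticeModels.fkDomainMeasure R.carrier δ (t / (1 + t)) (t ^ 2) (R.arc 0 ∪ R.arc 2)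 (Literature.Probability.LatticeModels.meshDomain_finite R.isBounded h).fintype).real (Literature.Probability.Percolation.discreteCrossing R.carrier δ (R.arc 0) (R.arc 2)) else 0) → ∀ R : Literature.Probability.RandomPlanarGeometry.ConformalRectangle, ∃ c ∈ Set.Ioc (0:ℝ) 1, ∃ᶠ t in 𝓝[≠] c, t ∈ Set.Ioc (0:ℝ) 1 ∧ R.HasCrossingLimit (fun δ => uJ R t δ) (U t)) → Summit.CriticalPhenomena.CardyFormulaZ2.Theses.CardyUSTContinuation.SmallFugacityLimit := by
  intro hA hW
  have hC := continuumFamily_proof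
  unfold ContinuumFamily at hC
  unfold UniformAnalyticExtension at hA
  unfold SmallFugacityLimit
  intro Z U uJ R
  have hWR := hW Z U uJ (fun _ _ => rfl) (fun _ _ => rfl) (fun _ _ _ => rfl) R
  refine ⟨1, one_pos, fun t ht => ?_⟩
  exact hasCrossingLimit_of_frequently _ _ R (hA R) hC.2 hWR t ⟨ht.1, ht.2.le⟩

end Summit.CriticalPhenomena.CardyFormulaZ2.Cruxes.Target.CardyUSTContinuationBirth
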